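import Literature.NumberTheory.EllipticCurves.ZpExtensionShapiroToEisensteinTowerHom
import HarnessLib

/-!
# The level maps of the pushforward `Hom` in the EXACT currency of `CoeffTowerSetting.Hom`: additive maps
# `CoeffLevel (shapiroIdeal) E σ →+ EisensteinLevel p m E k` with the fields `f_smul` (over `Λ ↠ S_m = Λ/(q_m)`),
# `f_equivariant` and `f_red` as stated in lit's `TowerMorphism` (definitions with bodies + theorems)

Topic `NumberTheory/EllipticCurves` (sequel of `ZpExtensionShapiroToEisensteinTowerHom`). Cell `pub/bsd-print-x9`, seat
`bsd-line-x9-p2` (g3): STUB A of the shared μ-skeleton v3 — «ONE `Hom` into St» (x9-p1 LEAD g3 17:24:48Z). lit's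
`CoeffTowerSetting.Hom φ S S′` (file `Howard2004/TowerMorphism`) asks for `f : ∀ k, N k →+ N′ k` with
`f_smul : f k (r • x) = φ r • f k x`, `f_equivariant : f k (S.T.ρ k σ x) = S′.T.ρ k σ (f k x)`,
`f_red : f k (S.T.red k x) = S′.T.red k (f (k+1) x)`. For `S.T = T_Λ.reindex s₀ d` (levels `CoeffLevel p (shapiroIdeal p) E (σ k)`,
`σ = idxSeq s₀ d`, `red k = T_Λ.redIter (σ k) (d k)`, ring `R = Λ`) and `S′.T = κ.eisensteinAdicTowerSucc E t hm` (levels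
`EisensteinLevel p m E (k+1)`, ring `S_m`, `φ = Ideal.Quotient.mk (q_m)`), this file gives the three fields VERBATIM:

* `shapiroToEisensteinLevelMap κ hm σ k hσ hle : CoeffLevel p (shapiroIdeal p) (E[p^·]) σ →+ EisensteinLevel p m (E[p^·]) k`
  (`shapiroToEisensteinTwistLe` on the synonyms);
* **`shapiroToEisensteinLevelMap_smul`** (`f (g • x) = (Ideal.Quotient.mk (q_m) g) • f x`, the `Λ`-action on the source level
  and the `S_m`-action on the target level), **`_equivariant`** (against `coeffAdicTower.ρ` / `eisensteinTwist`),
  **`_redIter`** (`f_{σ,k+1} (T_Λ.redIter σ d x) = (eisensteinAdicTowerSucc).red k (f_{σ+d,k+2} x)`);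
* `cohomologyMap_shapiroToEisensteinLevelMap_eq` : the `Hom.fH1` built from it is `galoisCohomology.map (shapiroToEisensteinTwistLe …) 1`,
  so `map_shapiroToEisensteinTwistLe_toShapiroLimitH1_eq_proj_toEisensteinH1` applies to `fH1`.
DEFINITIONS WITH BODIES + theorems; no named fact, no instance, no notation, no `sorry`. BSD is not proved by any of this.

References: [Howard2004HeegnerKolyvagin] B. Howard, Compositio Math. 140 (2004), Rem. 1.2.4 (arXiv Rem. 2.2.4, p. 7, L13–27),
§1.6 (arXiv p. 12), §2.2 Def. 2.2.3 and proof of Thm. 2.2.10; [Washington1997] §13.2; [SerreGaloisCohomology1997] I §2.2.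
-/

noncomputable section

open scoped Topology Classical ContRepresentation
open Field CategoryTheory IsLocalRing

namespace Literature.NumberTheory.EllipticCurves.ZpExtension

open Literature.NumberTheory.GaloisRepresentations
open Literature.NumberTheory.GaloisCohomology.Howard2004

variable {K : Type} [Field K] [NumberField K] {V : WeierstrassCurve K} [V.IsElliptic] {p : ℕ} [hp : Fact p.Prime]
  (κ : ZpExtension K p)
  (t : ∀ k, (V.torsionGaloisModule ((p : ℤ) ^ (k + 1))).toContRepresentation →ⁱL
    (V.torsionGaloisModule ((p : ℤ) ^ k)).toContRepresentation)
  (ht : ∀ k (P : WeierstrassCurve.geomTorsion V ((p : ℤ) ^ (k + 1))), t k P = V.geomTorsionReduce p k P)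
  (hts : ∀ k, Function.Surjective (t k)) {m : ℕ} (hm : 1 ≤ m)

variable (V) in
/-- **The level map of the pushforward `Hom` as an additive map of the level SYNONYMS**:
`CoeffLevel p (shapiroIdeal p) (E[p^·]) σ →+ EisensteinLevel p m (E[p^·]) k` (`shapiroToEisensteinTwistLe` underneath).
[cite: Howard2004HeegnerKolyvagin, Rem. 1.2.4 (arXiv p. 7, L13–27)] -/
def shapiroToEisensteinLevelMap (σ k : ℕ) (hσ : k ≤ σ)
    (hle : shapiroIdeal p σ ≤ Ideal.span {(PowerSeries.X ^ m + PowerSeries.C (p : ℤ_[p]) : IwasawaAlgebra p)} ⊔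
      Ideal.span {PowerSeries.C ((p : ℤ_[p]) ^ k)}) :
    CoeffLevel p (shapiroIdeal p) (fun j ↦ WeierstrassCurve.geomTorsion V ((p : ℤ) ^ j)) σ →+
      EisensteinLevel p m (fun j ↦ WeierstrassCurve.geomTorsion V ((p : ℤ) ^ j)) k where
  toFun x := (κ.shapiroToEisensteinTwistLe V hm σ k hσ hle
    (x : QuotTwisted (IwasawaAlgebra p ⧸ shapiroIdeal p σ) (WeierstrassCurve.geomTorsion V ((p : ℤ) ^ σ))) :
      IwasawaAlgebra.EisensteinCoeff.Twisted p m k (WeierstrassCurve.geomTorsion V ((p : ℤ) ^ k)))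
  map_zero' := map_zero _
  map_add' _ _ := map_add _ _ _

omit [NumberField K] [V.IsElliptic] in
/-- Unfolding `shapiroToEisensteinLevelMap`: it is `shapiroToEisensteinTwistLe` on carriers. [cite: Howard2004HeegnerKolyvagin, Rem. 1.2.4] -/
theorem shapiroToEisensteinLevelMap_apply (σ k : ℕ) (hσ : k ≤ σ)
    (hle : shapiroIdeal p σ ≤ Ideal.span {(PowerSeries.X ^ m + PowerSeries.C (p : ℤ_[p]) : IwasawaAlgebra p)} ⊔
      Ideal.span {PowerSeries.C ((p : ℤ_[p]) ^ k)})
    (x : CoeffLevel p (shapiroIdeal p) (fun j ↦ WeierstrassCurve.geomTorsion V ((p : ℤ) ^ j)) σ) :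
    κ.shapiroToEisensteinLevelMap V hm σ k hσ hle x =
      κ.shapiroToEisensteinTwistLe V hm σ k hσ hle
        (x : QuotTwisted (IwasawaAlgebra p ⧸ shapiroIdeal p σ) (WeierstrassCurve.geomTorsion V ((p : ℤ) ^ σ))) :=
  rfl

omit [NumberField K] [V.IsElliptic] in
/-- **`Hom.f_smul`**: `f (g • x) = [g]_{S_m} • f x` for `g ∈ Λ` (the `Λ`-action on the source level is through `Λ/I_σ`,
the `S_m`-action on the target level through `S_m ↠ A_{m,k}`; both are `[g]_{A_{m,k}} •` after `f`).
[cite: Howard2004HeegnerKolyvagin, Rem. 1.2.4 (i) (arXiv p. 7, L13–17)] -/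
theorem shapiroToEisensteinLevelMap_smul (σ k : ℕ) (hσ : k ≤ σ)
    (hle : shapiroIdeal p σ ≤ Ideal.span {(PowerSeries.X ^ m + PowerSeries.C (p : ℤ_[p]) : IwasawaAlgebra p)} ⊔
      Ideal.span {PowerSeries.C ((p : ℤ_[p]) ^ k)})
    (g : IwasawaAlgebra p) (x : CoeffLevel p (shapiroIdeal p) (fun j ↦ WeierstrassCurve.geomTorsion V ((p : ℤ) ^ j)) σ) :
    κ.shapiroToEisensteinLevelMap V hm σ k hσ hle (g • x) =
      (Ideal.Quotient.mk (Ideal.span {(PowerSeries.X ^ m + PowerSeries.C (p : ℤ_[p]) : IwasawaAlgebra p)}) g) •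
        κ.shapiroToEisensteinLevelMap V hm σ k hσ hle x := by
  rw [EisensteinLevel.quotient_mk_smul_def]
  refine (κ.shapiroToEisensteinTwistLe_smul hm σ k hσ hle (Ideal.Quotient.mk (shapiroIdeal p σ) g)
    (x : QuotTwisted (IwasawaAlgebra p ⧸ shapiroIdeal p σ) (WeierstrassCurve.geomTorsion V ((p : ℤ) ^ σ)))).trans ?_
  rw [shapiroToEisensteinCoeff_mk]
  rfl

omit [NumberField K] [V.IsElliptic] in
/-- **`Hom.f_equivariant`**: `f (ρ_σ(γ) x) = ρ′_k(γ) (f x)` against the source level representation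
`(coeffAdicTower …).ρ σ = κ.coeffTwist E[p^σ] [1+T] σ _` and the target `κ.eisensteinTwist E[p^k] hm k`.
[cite: Howard2004HeegnerKolyvagin, Rem. 1.2.4 (arXiv p. 7, L13–27)] -/
theorem shapiroToEisensteinLevelMap_equivariant (σ k : ℕ) (hσ : k ≤ σ)
    (hle : shapiroIdeal p σ ≤ Ideal.span {(PowerSeries.X ^ m + PowerSeries.C (p : ℤ_[p]) : IwasawaAlgebra p)} ⊔
      Ideal.span {PowerSeries.C ((p : ℤ_[p]) ^ k)})
    (γ' : absoluteGaloisGroup K) (x : CoeffLevel p (shapiroIdeal p) (fun j ↦ WeierstrassCurve.geomTorsion V ((p : ℤ) ^ j)) σ) :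
    κ.shapiroToEisensteinLevelMap V hm σ k hσ hle
        ((κ.coeffAdicTower (fun j ↦ V.torsionGaloisModule ((p : ℤ) ^ j)) t (shapiroIdeal p) (shapiroIdeal_succ_le p)
          (fun j ↦ j) (omega_mem_shapiroIdeal p) (fun j ↦ j * p ^ j + j) (maximalIdeal_pow_le_shapiroIdeal p) hts).ρ σ γ' x) =
      (κ.eisensteinTwist (V.torsionGaloisModule ((p : ℤ) ^ k)) hm k :
          ContinuousRep (absoluteGaloisGroup K) ℤ (EisensteinLevel p m (fun j ↦ WeierstrassCurve.geomTorsion V ((p : ℤ) ^ j)) k))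
        γ' (κ.shapiroToEisensteinLevelMap V hm σ k hσ hle x) :=
  congrArg (fun φ ↦ φ (x : QuotTwisted (IwasawaAlgebra p ⧸ shapiroIdeal p σ) (WeierstrassCurve.geomTorsion V ((p : ℤ) ^ σ))))
    ((κ.shapiroToEisensteinTwistLe V hm σ k hσ hle).isIntertwining' γ')

include ht in
omit [NumberField K] [V.IsElliptic] in
/-- **`Hom.f_red`** (consecutive target levels `k+1 ≤ k+2`, source levels `σ ≤ σ + d`): reducing in the source
(`redIter` of the Shapiro `coeffAdicTower` = `(T_Λ.reindex s₀ d).red k` at `σ = idxSeq s₀ d k`, `d = d k`) then mapping equals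
mapping then reducing in the target (`(κ.eisensteinAdicTowerSucc E t hm hts).red k`).
[cite: Howard2004HeegnerKolyvagin, Rem. 1.2.4 (arXiv p. 7, L13–27) and §1.6 (arXiv p. 12, L29–33)] -/
theorem shapiroToEisensteinLevelMap_redIter (σ d k : ℕ) (hσ : k + 1 ≤ σ) (hσ' : k + 2 ≤ σ + d)
    (hle : shapiroIdeal p σ ≤ Ideal.span {(PowerSeries.X ^ m + PowerSeries.C (p : ℤ_[p]) : IwasawaAlgebra p)} ⊔
      Ideal.span {PowerSeries.C ((p : ℤ_[p]) ^ (k + 1))})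
    (hle' : shapiroIdeal p (σ + d) ≤ Ideal.span {(PowerSeries.X ^ m + PowerSeries.C (p : ℤ_[p]) : IwasawaAlgebra p)} ⊔
      Ideal.span {PowerSeries.C ((p : ℤ_[p]) ^ (k + 2))})
    (x : CoeffLevel p (shapiroIdeal p) (fun j ↦ WeierstrassCurve.geomTorsion V ((p : ℤ) ^ j)) (σ + d)) :
    letI := IwasawaAlgebra.isLocalRing_quotient_X_pow_add_C p hm
    κ.shapiroToEisensteinLevelMap V hm σ (k + 1) hσ hle
        ((κ.coeffAdicTower (fun j ↦ V.torsionGaloisModule ((p : ℤ) ^ j)) t (shapiroIdeal p) (shapiroIdeal_succ_le p)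
          (fun j ↦ j) (omega_mem_shapiroIdeal p) (fun j ↦ j * p ^ j + j) (maximalIdeal_pow_le_shapiroIdeal p) hts).redIter
          σ d x) =
      (κ.eisensteinAdicTowerSucc (fun j ↦ V.torsionGaloisModule ((p : ℤ) ^ j)) t hm hts).red k
        (κ.shapiroToEisensteinLevelMap V hm (σ + d) (k + 2) hσ' hle' x) :=
  κ.shapiroToEisensteinTwistLe_redIter t ht hts hm σ d k hσ hσ' hle hle' x

omit [NumberField K] [V.IsElliptic] in
/-- **`H¹` of the level map is `galoisCohomology.map (shapiroToEisensteinTwistLe …) 1`**: the `Hom.fH1` built from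
`shapiroToEisensteinLevelMap` (`ContinuousRep.cohomologyMap` of the additive map with its equivariance) coincides with the
functorial map of the intertwining map, so the hook `map_shapiroToEisensteinTwistLe_toShapiroLimitH1_eq_proj_toEisensteinH1`
computes `fH1 ∘ Φ`. [cite: SerreGaloisCohomology1997, I §2.2] [cite: Howard2004HeegnerKolyvagin, Rem. 1.2.4 (iii)] -/
theorem cohomologyMap_shapiroToEisensteinLevelMap_eq (σ k : ℕ) (hσ : k ≤ σ)
    (hle : shapiroIdeal p σ ≤ Ideal.span {(PowerSeries.X ^ m + PowerSeries.C (p : ℤ_[p]) : IwasawaAlgebra p)} ⊔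
      Ideal.span {PowerSeries.C ((p : ℤ_[p]) ^ k)}) :
    ContinuousRep.cohomologyMap
        ((κ.coeffAdicTower (fun j ↦ V.torsionGaloisModule ((p : ℤ) ^ j)) t (shapiroIdeal p) (shapiroIdeal_succ_le p)
          (fun j ↦ j) (omega_mem_shapiroIdeal p) (fun j ↦ j * p ^ j + j) (maximalIdeal_pow_le_shapiroIdeal p) hts).ρ σ)
        (κ.eisensteinTwist (V.torsionGaloisModule ((p : ℤ) ^ k)) hm k :
          ContinuousRep (absoluteGaloisGroup K) ℤ (EisensteinLevel p m (fun j ↦ WeierstrassCurve.geomTorsion V ((p : ℤ) ^ j)) k))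
        (κ.shapiroToEisensteinLevelMap V hm σ k hσ hle) continuous_of_discreteTopology
        (κ.shapiroToEisensteinLevelMap_equivariant t hts hm σ k hσ hle) 1 =
      galoisCohomology.map (κ.shapiroToEisensteinTwistLe V hm σ k hσ hle) 1 := by
  refine AddMonoidHom.ext fun y ↦ ?_
  obtain ⟨φ, rfl⟩ := oneCocycleClass_surjective _ y
  change ContinuousCohomology.map _ _ 1 _ = ContinuousCohomology.map _ _ 1 _
  erw [map_oneCocycleClass]

end Literature.NumberTheory.EllipticCurves.ZpExtension

end
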